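import Summits.QuantumFields.YangMills.Theorems.IR.BlockedActivityWRefine
import HarnessLib

/-!
# Crux `IR` (stmt-QuantumFields-19354), lane B «strong coupling AFTER BLOCKING»: VARIABLE-PIECE frame refinement — every frame with interval lengths
# `≥ b` splits into a mesh-`b` frame (geometry only; the tool for TAIL cofinality in the mesh)

Helper module for item `stmt-QuantumFields-19354` (`--supports`; it closes nothing), lane `ym-19354-onsetsc-p2` (g6).  `Theorems/IR/BlockedActivityWRefine` splits a
mesh-`K·b` frame into `K` pieces per interval (uniform count), reaching only the MULTIPLES `K·b` of a mixing mesh `b`.  Here every frame `w` whose interval lengths are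
`≥ b` (e.g. any mesh-`B` frame, `B ≥ b`) is refined into a mesh-`b` frame with `⌊gap∕b⌋` pieces per interval (greedy fill as before); the fine index is decoded
through the CUMULATIVE piece count `cumPieces b w i : ℤ → ℤ` (normalised at `0`) by the tree's `frameIdx`.

* §1 `pieceCount`, `cumPieces`, `cumPieces_zero`, `cumPieces_succ`, `one_le_pieceCount` ∕ `pieceCount_mul_le` ∕ `lt_pieceCount_succ_mul` (`⌊gap∕b⌋·b ≤ gap <
  (⌊gap∕b⌋+1)·b`), `cumPieces_step` (strictly increasing), monotonicity of `frameIdx` (`le_frameIdx_of_le`, `frameIdx_lt_of_lt`).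
* §2 `refineGen b w` (fine breakpoint `k ↦ min (w i (J+1) − (pc J − R)·b) (w i J + 2R·b)`, `J = frameIdx (cumPieces b w i) k`, `R = k − cumPieces b w i J`),
  `refineGen_cum` (coarse breakpoints are fine breakpoints), `isFrame_refineGen` (mesh `b`), `le_refineGen` ∕ `refineGen_succ_le`.
* §3 cells: `cellEdges_refineGen_subset`, `frameCell_eq_coarseIdx_refineGen`, `regionEdges_union_refineGen`, `cellEdges_union_refineGen`, `innerEdges_union_refineGen`;
  the fine cells of the coarse centre cell lie in the box `∏ [0, pc_i 0)` (`fineCells_centre_subset_gen`) of cardinality `≤ (2(B∕b)+1)⁴` for a mesh-`B` frame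
  (`card_fineCells_centre_le_gen`); window geometry `coarseIdx_mem_window_of_near` (fine cells within index distance `N ≤ 2(B∕b)` of the centre's fine cells have coarse
  index in `[-2, 2]`).

HONEST FRAMING: bookkeeping; nothing about mixing, a gap or Clay.  No `sorry`; axioms ⊆ {propext, Classical.choice, Quot.sound}; no instances, no notation.
-/

set_option autoImplicit false

noncomputable section

open Literature.MathematicalPhysics.QuantumLattice
open Summit.QuantumFields.YangMills.Cruxes.IR.Tempered (cellEdges windowCells regionEdges collarEdges)
open Summit.QuantumFields.YangMills.Cruxes.IR.CellTempered.Engine (frameIdx frameIdx_le lt_frameIdx_succ frameIdx_eq_iff frame_add_nat_le frameCell frameCell_eq_iff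
  mem_cellEdges_frameCell frame_hC1 regionEdges_union)

namespace Summit.QuantumFields.YangMills.Cruxes.IR.BlockedActivity

/-! ## §1 Piece counts and their cumulative sums -/

section Pieces

variable {B b : ℕ} {w : Fin 4 → ℤ → ℤ}

/-- The number of fine pieces of the coarse interval `j` on axis `i`: `⌊(w i (j+1) − w i j) ∕ b⌋`. -/
def pieceCount (b : ℕ) (w : Fin 4 → ℤ → ℤ) (i : Fin 4) (j : ℤ) : ℤ := (w i (j + 1) - w i j) / (b : ℤ)

/-- The cumulative piece count, normalised by `cumPieces b w i 0 = 0`: the fine index of the coarse breakpoint `j`. -/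
def cumPieces (b : ℕ) (w : Fin 4 → ℤ → ℤ) (i : Fin 4) (j : ℤ) : ℤ :=
  if 0 ≤ j then ∑ k ∈ Finset.range j.toNat, pieceCount b w i k
  else -∑ k ∈ Finset.range (-j).toNat, pieceCount b w i (-(k : ℤ) - 1)

/-- `cumPieces 0 = 0`. -/
theorem cumPieces_zero (i : Fin 4) : cumPieces b w i 0 = 0 := by
  simp [cumPieces]

/-- `cumPieces (j+1) = cumPieces j + pieceCount j`. -/
theorem cumPieces_succ (i : Fin 4) (j : ℤ) : cumPieces b w i (j + 1) = cumPieces b w i j + pieceCount b w i j := by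
  rcases le_or_gt 0 j with hj | hj
  · obtain ⟨N, rfl⟩ := Int.eq_ofNat_of_zero_le hj
    have h1 : ((N : ℤ) + 1).toNat = N + 1 := by
      have : ((N : ℤ) + 1) = ((N + 1 : ℕ) : ℤ) := by push_cast; ring
      rw [this, Int.toNat_natCast]
    have h0 : (0 : ℤ) ≤ (N : ℤ) + 1 := by positivity
    simp only [cumPieces, h0, hj, if_true, h1, Int.toNat_natCast, Finset.sum_range_succ]
  · obtain ⟨M, rfl⟩ : ∃ M : ℕ, j = -((M : ℤ) + 1) := ⟨(-j - 1).toNat, by omega⟩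
    have e1 : -((M : ℤ) + 1) + 1 = -(M : ℤ) := by ring
    have hneg : ¬ (0 : ℤ) ≤ -((M : ℤ) + 1) := by omega
    have h1 : (-(-((M : ℤ) + 1))).toNat = M + 1 := by
      have : (-(-((M : ℤ) + 1))) = ((M + 1 : ℕ) : ℤ) := by push_cast; ring
      rw [this, Int.toNat_natCast]
    rw [e1]
    rcases Nat.eq_zero_or_pos M with hM | hM
    · subst hM
      simp [cumPieces]
    · have hneg' : ¬ (0 : ℤ) ≤ -(M : ℤ) := by omega
      have h2 : (-(-(M : ℤ))).toNat = M := by rw [neg_neg, Int.toNat_natCast]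
      simp only [cumPieces, hneg, hneg', if_false, h1, h2]
      rw [Finset.sum_range_succ]
      have e2 : (-((M : ℕ) : ℤ) - 1) = -((M : ℤ) + 1) := by ring
      rw [e2]
      ring

/-- For a frame with interval lengths `≥ b ≥ 1`: `pieceCount ≥ 1`. -/
theorem one_le_pieceCount (hb : 1 ≤ b) (hbB : b ≤ B) (hw : AfPincerUc.IsFrame B w) (i : Fin 4) (j : ℤ) : 1 ≤ pieceCount b w i j := by
  have hbpos : (0 : ℤ) < (b : ℤ) := by exact_mod_cast hb
  have hg := (hw i j).1
  have hbB' : ((b : ℕ) : ℤ) ≤ ((B : ℕ) : ℤ) := by exact_mod_cast hbB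
  exact Int.le_ediv_of_mul_le hbpos (by linarith)

/-- `pieceCount·b ≤ gap`. -/
theorem pieceCount_mul_le (hb : 1 ≤ b) (i : Fin 4) (j : ℤ) : pieceCount b w i j * (b : ℤ) ≤ w i (j + 1) - w i j := by
  have hbpos : (0 : ℤ) < (b : ℤ) := by exact_mod_cast hb
  exact Int.ediv_mul_le _ hbpos.ne'

/-- `gap < (pieceCount + 1)·b`. -/
theorem lt_pieceCount_succ_mul (hb : 1 ≤ b) (i : Fin 4) (j : ℤ) : w i (j + 1) - w i j < (pieceCount b w i j + 1) * (b : ℤ) := by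
  have hbpos : (0 : ℤ) < (b : ℤ) := by exact_mod_cast hb
  exact Int.lt_ediv_add_one_mul_self _ hbpos

/-- The cumulative count is a frame in the engine's sense: `cumPieces j + 1 ≤ cumPieces (j+1)`. -/
theorem cumPieces_step (hb : 1 ≤ b) (hbB : b ≤ B) (hw : AfPincerUc.IsFrame B w) (i : Fin 4) :
    ∀ j, cumPieces b w i j + 1 ≤ cumPieces b w i (j + 1) := fun j => by
  rw [cumPieces_succ]
  linarith [one_le_pieceCount hb hbB hw i j]

/-- Monotonicity of an engine frame (public twin of the tree's private `frame_mono`). -/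
theorem frame_le_of_le {f : ℤ → ℤ} (hf : ∀ j, f j + 1 ≤ f (j + 1)) {j j' : ℤ} (h : j ≤ j') : f j ≤ f j' := by
  obtain ⟨m, rfl⟩ : ∃ m : ℕ, j' = j + m := ⟨(j' - j).toNat, by omega⟩
  have := frame_add_nat_le hf j m
  linarith

/-- `f a ≤ t ⇒ a ≤ frameIdx f t`. -/
theorem le_frameIdx_of_le {f : ℤ → ℤ} (hf : ∀ j, f j + 1 ≤ f (j + 1)) {a t : ℤ} (h : f a ≤ t) : a ≤ frameIdx f t := by
  by_contra hlt
  push Not at hlt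
  have h1 : f (frameIdx f t + 1) ≤ f a := frame_le_of_le hf (by omega)
  linarith [lt_frameIdx_succ hf t]

/-- `t < f a ⇒ frameIdx f t < a`. -/
theorem frameIdx_lt_of_lt {f : ℤ → ℤ} (hf : ∀ j, f j + 1 ≤ f (j + 1)) {a t : ℤ} (h : t < f a) : frameIdx f t < a := by
  by_contra hle
  push Not at hle
  have h1 : f a ≤ f (frameIdx f t) := frame_le_of_le hf hle
  linarith [frameIdx_le hf t]

end Pieces

/-! ## §2 The variable-piece refinement -/

section RefineGen

variable {B b : ℕ} {w : Fin 4 → ℤ → ℤ}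

/-- The coarse interval of the fine index `k` (axis `i`). -/
def coarseIdx (b : ℕ) (w : Fin 4 → ℤ → ℤ) (i : Fin 4) (k : ℤ) : ℤ := frameIdx (cumPieces b w i) k

/-- The position of the fine index `k` inside its coarse interval. -/
def pieceIdx (b : ℕ) (w : Fin 4 → ℤ → ℤ) (i : Fin 4) (k : ℤ) : ℤ := k - cumPieces b w i (coarseIdx b w i k)

/-- **The variable-piece refinement**: fine breakpoint `k` on axis `i` is `min (w i (J+1) − (pc J − R)·b) (w i J + 2R·b)`, `J = coarseIdx`, `R = pieceIdx`. -/
def refineGen (b : ℕ) (w : Fin 4 → ℤ → ℤ) : Fin 4 → ℤ → ℤ := fun i k =>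
  min (w i (coarseIdx b w i k + 1) - (pieceCount b w i (coarseIdx b w i k) - pieceIdx b w i k) * (b : ℤ))
    (w i (coarseIdx b w i k) + 2 * pieceIdx b w i k * (b : ℤ))

variable (hb : 1 ≤ b) (hbB : b ≤ B) (hw : AfPincerUc.IsFrame B w)
include hb hbB hw

/-- The decoding of a fine index: `cum J ≤ k < cum (J+1)`, i.e. `0 ≤ R < pc J`. -/
theorem pieceIdx_bounds (i : Fin 4) (k : ℤ) : 0 ≤ pieceIdx b w i k ∧ pieceIdx b w i k < pieceCount b w i (coarseIdx b w i k) := by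
  have hc := cumPieces_step hb hbB hw i
  have h1 := frameIdx_le hc k
  have h2 := lt_frameIdx_succ hc k
  unfold pieceIdx coarseIdx
  rw [cumPieces_succ] at h2
  constructor <;> linarith

/-- The coarse breakpoints decode to themselves: `coarseIdx (cum j) = j`. -/
theorem coarseIdx_cum (i : Fin 4) (j : ℤ) : coarseIdx b w i (cumPieces b w i j) = j :=
  (frameIdx_eq_iff (cumPieces_step hb hbB hw i) _ _).2 ⟨le_rfl, by linarith [cumPieces_step hb hbB hw i j]⟩

/-- **The coarse breakpoints are fine breakpoints**: `refineGen b w i (cumPieces b w i j) = w i j`. -/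
theorem refineGen_cum (i : Fin 4) (j : ℤ) : refineGen b w i (cumPieces b w i j) = w i j := by
  have hJ := coarseIdx_cum hb hbB hw i j
  have hR : pieceIdx b w i (cumPieces b w i j) = 0 := by unfold pieceIdx; rw [hJ, sub_self]
  simp only [refineGen, hJ, hR, sub_zero, mul_zero, zero_mul, add_zero]
  exact min_eq_right (by linarith [pieceCount_mul_le (w := w) hb i j])

/-- The successor of a fine index inside a coarse interval. -/
theorem coarseIdx_succ_of_lt (i : Fin 4) {k : ℤ} (h : pieceIdx b w i k + 1 < pieceCount b w i (coarseIdx b w i k)) :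
    coarseIdx b w i (k + 1) = coarseIdx b w i k ∧ pieceIdx b w i (k + 1) = pieceIdx b w i k + 1 := by
  have hc := cumPieces_step hb hbB hw i
  have h1 := frameIdx_le hc k
  have hJ : coarseIdx b w i (k + 1) = coarseIdx b w i k := by
    refine (frameIdx_eq_iff hc _ _).2 ⟨?_, ?_⟩
    · unfold coarseIdx; linarith
    · rw [cumPieces_succ]; unfold pieceIdx coarseIdx at h; unfold coarseIdx; linarith
  refine ⟨hJ, ?_⟩
  unfold pieceIdx
  rw [hJ]
  ring

omit hb hbB hw in
/-- The successor of the last fine index of a coarse interval. -/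
theorem coarseIdx_succ_of_eq (i : Fin 4) {k : ℤ} (h : pieceIdx b w i k + 1 = pieceCount b w i (coarseIdx b w i k)) :
    k + 1 = cumPieces b w i (coarseIdx b w i k + 1) := by
  rw [cumPieces_succ]
  unfold pieceIdx at h
  linarith

/-- **The refinement is a mesh-`b` frame.** -/
theorem isFrame_refineGen : AfPincerUc.IsFrame b (refineGen b w) := by
  intro i k
  have hb0 : (0 : ℤ) ≤ (b : ℤ) := by positivity
  obtain ⟨hr0, hrK⟩ := pieceIdx_bounds hb hbB hw i k
  set J := coarseIdx b w i k with hJ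
  set R := pieceIdx b w i k with hR
  have hgl := pieceCount_mul_le (w := w) hb i J
  have hgu := lt_pieceCount_succ_mul (w := w) hb i J
  by_cases hlast : R + 1 < pieceCount b w i J
  · obtain ⟨hJ', hR'⟩ := coarseIdx_succ_of_lt hb hbB hw i (k := k) hlast
    have e1 : w i (J + 1) - (pieceCount b w i J - (R + 1)) * (b : ℤ) = (w i (J + 1) - (pieceCount b w i J - R) * (b : ℤ)) + (b : ℤ) := by ring
    have e2 : w i J + 2 * (R + 1) * (b : ℤ) = (w i J + 2 * R * (b : ℤ)) + 2 * (b : ℤ) := by ring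
    have hstep := min_step_bounds (X := w i (J + 1) - (pieceCount b w i J - R) * (b : ℤ)) (Y := w i J + 2 * R * (b : ℤ)) hb0
    simp only [refineGen]
    rw [hJ', hR', ← hJ, ← hR, e1, e2]
    constructor <;> linarith [hstep.1, hstep.2]
  · have hRK : R + 1 = pieceCount b w i J := le_antisymm (by linarith) (not_lt.1 hlast)
    have hk1 := coarseIdx_succ_of_eq i (k := k) hRK
    have hval : refineGen b w i (k + 1) = w i (J + 1) := by rw [hk1, refineGen_cum hb hbB hw]
    rw [hval]
    have hKr : pieceCount b w i J - R = 1 := by linarith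
    simp only [refineGen]
    rw [← hJ, ← hR, hKr, one_mul]
    -- `gap ∈ [pc·b, (pc+1)·b)` with `pc = R + 1`: `w(J+1) − b ≥ w J + 2Rb − b + …`
    have h2R : 2 * R * (b : ℤ) = 2 * (pieceCount b w i J * (b : ℤ)) - 2 * (b : ℤ) := by rw [← hRK]; ring
    rw [h2R]
    rcases le_total (w i (J + 1) - (b : ℤ)) (w i J + (2 * (pieceCount b w i J * (b : ℤ)) - 2 * (b : ℤ))) with h | h
    · rw [min_eq_left h]; constructor <;> nlinarith
    · rw [min_eq_right h]; constructor <;> nlinarith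

/-- A fine breakpoint is at or after its coarse breakpoint. -/
theorem le_refineGen (i : Fin 4) (k : ℤ) : w i (coarseIdx b w i k) ≤ refineGen b w i k := by
  have hb0 : (0 : ℤ) ≤ (b : ℤ) := by positivity
  obtain ⟨hr0, hrK⟩ := pieceIdx_bounds hb hbB hw i k
  have hgl := pieceCount_mul_le (w := w) hb i (coarseIdx b w i k)
  simp only [refineGen]
  refine le_min ?_ ?_
  · have h1 : (pieceCount b w i (coarseIdx b w i k) - pieceIdx b w i k) * (b : ℤ) ≤ pieceCount b w i (coarseIdx b w i k) * (b : ℤ) := by nlinarith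
    linarith
  · nlinarith

/-- The next fine breakpoint is at or before the next coarse breakpoint. -/
theorem refineGen_succ_le (i : Fin 4) (k : ℤ) : refineGen b w i (k + 1) ≤ w i (coarseIdx b w i k + 1) := by
  have hb0 : (0 : ℤ) ≤ (b : ℤ) := by positivity
  obtain ⟨hr0, hrK⟩ := pieceIdx_bounds hb hbB hw i k
  by_cases hlast : pieceIdx b w i k + 1 < pieceCount b w i (coarseIdx b w i k)
  · obtain ⟨hJ', hR'⟩ := coarseIdx_succ_of_lt hb hbB hw i (k := k) hlast
    simp only [refineGen]
    rw [hJ', hR']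
    refine (min_le_left _ _).trans ?_
    have h1 : 0 ≤ (pieceCount b w i (coarseIdx b w i k) - (pieceIdx b w i k + 1)) * (b : ℤ) := by nlinarith
    linarith
  · have hRK : pieceIdx b w i k + 1 = pieceCount b w i (coarseIdx b w i k) := le_antisymm (by linarith) (not_lt.1 hlast)
    rw [coarseIdx_succ_of_eq i hRK, refineGen_cum hb hbB hw]

end RefineGen

/-! ## §3 Cells -/

section Cells

variable {B b : ℕ} {w : Fin 4 → ℤ → ℤ} (hb : 1 ≤ b) (hbB : b ≤ B) (hw : AfPincerUc.IsFrame B w)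
include hb hbB hw

/-- **The fine cell `k` lies in the coarse cell `(coarseIdx kᵢ)ᵢ`.** -/
theorem cellEdges_refineGen_subset (m : Cell) : cellEdges (refineGen b w) m ⊆ cellEdges w (fun i => coarseIdx b w i (m i)) := by
  intro v hv
  simp only [Summit.QuantumFields.YangMills.Cruxes.IR.Tempered.cellEdges, Finset.mem_product, Finset.mem_univ, and_true,
    Fintype.mem_piFinset, Finset.mem_Ico] at hv ⊢
  intro i
  obtain ⟨h1, h2⟩ := hv i
  exact ⟨(le_refineGen hb hbB hw i (m i)).trans h1, h2.trans_le (refineGen_succ_le hb hbB hw i (m i))⟩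

/-- **The coarse cell of a link is decoded from its fine cell.** -/
theorem frameCell_eq_coarseIdx_refineGen (v : ZdEdge 4) : frameCell w v = fun i => coarseIdx b w i (frameCell (refineGen b w) v i) := by
  have hB : 1 ≤ B := hb.trans hbB
  exact (frameCell_eq_iff (frame_step hw hB) v _).2 (cellEdges_refineGen_subset hb hbB hw _ (mem_cellEdges_frameCell (frame_step (isFrame_refineGen hb hbB hw) hb) v))

/-- Links in one fine cell lie in one coarse cell. -/
theorem coarse_frameCell_eq_of_fine_gen {v v' : ZdEdge 4} (h : frameCell (refineGen b w) v = frameCell (refineGen b w) v') :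
    frameCell w v = frameCell w v' := by
  rw [frameCell_eq_coarseIdx_refineGen hb hbB hw v, frameCell_eq_coarseIdx_refineGen hb hbB hw v', h]

/-- A coarse region is a union of fine cells. -/
theorem regionEdges_union_refineGen (Y : Finset Cell) (v v' : ZdEdge 4) (h : frameCell (refineGen b w) v = frameCell (refineGen b w) v')
    (hv : v ∈ regionEdges w Y) : v' ∈ regionEdges w Y :=
  regionEdges_union (frame_step hw (hb.trans hbB)) Y v v' (coarse_frameCell_eq_of_fine_gen hb hbB hw h) hv

/-- A coarse cell is a union of fine cells. -/
theorem cellEdges_union_refineGen (c : Cell) (v v' : ZdEdge 4) (h : frameCell (refineGen b w) v = frameCell (refineGen b w) v')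
    (hv : v ∈ cellEdges w c) : v' ∈ cellEdges w c := by
  have hw1 := frame_step hw (hb.trans hbB)
  rw [← frameCell_eq_iff hw1] at hv ⊢
  rw [← coarse_frameCell_eq_of_fine_gen hb hbB hw h, hv]

/-- The inner volume of a coarse region is a union of fine cells. -/
theorem innerEdges_union_refineGen (Y : Finset Cell) (v v' : ZdEdge 4) (h : frameCell (refineGen b w) v = frameCell (refineGen b w) v')
    (hv : v ∈ innerEdges w Y) : v' ∈ innerEdges w Y := by
  simp only [innerEdges, Finset.mem_sdiff] at hv ⊢
  exact ⟨regionEdges_union_refineGen hb hbB hw Y v v' h hv.1, fun hv' => hv.2 (cellEdges_union_refineGen hb hbB hw 0 v' v h.symm hv')⟩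

/-- **The fine cells of the coarse centre cell lie in the box `∏ᵢ [0, pc_i 0)`.** -/
theorem fineCells_centre_subset_gen :
    (cellEdges w 0).image (frameCell (refineGen b w)) ⊆ Fintype.piFinset fun i : Fin 4 => Finset.Ico (0 : ℤ) (pieceCount b w i 0) := by
  intro y hy
  obtain ⟨e, he, rfl⟩ := Finset.mem_image.1 hy
  have hce : frameCell w e = 0 := (frameCell_eq_iff (frame_step hw (hb.trans hbB)) e 0).2 he
  rw [frameCell_eq_coarseIdx_refineGen hb hbB hw] at hce
  simp only [Fintype.mem_piFinset, Finset.mem_Ico]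
  intro i
  have hi : coarseIdx b w i (frameCell (refineGen b w) e i) = 0 := by
    have := congr_fun hce i
    simpa using this
  have hc := cumPieces_step hb hbB hw i
  have h1 := frameIdx_le hc (frameCell (refineGen b w) e i)
  have h2 := lt_frameIdx_succ hc (frameCell (refineGen b w) e i)
  unfold coarseIdx at hi
  rw [hi] at h1 h2
  rw [cumPieces_succ, cumPieces_zero, zero_add] at h2
  rw [cumPieces_zero] at h1
  exact ⟨h1, h2⟩

omit hbB in
/-- `pieceCount ≤ 2·(B∕b) + 1` on a mesh-`B` frame (`gap ≤ 2B`). -/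
theorem pieceCount_le (i : Fin 4) (j : ℤ) : pieceCount b w i j ≤ 2 * ((B / b : ℕ) : ℤ) + 1 := by
  have hbpos : (0 : ℤ) < (b : ℤ) := by exact_mod_cast hb
  have hg := (hw i j).2
  -- `gap ≤ 2B < (2(B/b) + 2)·b`
  have hB : (B : ℤ) < ((B / b : ℕ) : ℤ) * (b : ℤ) + (b : ℤ) := by
    have := Nat.lt_div_mul_add (a := B) hb
    exact_mod_cast this
  have hring : (2 * ((B / b : ℕ) : ℤ) + 1 + 1) * (b : ℤ) = 2 * (((B / b : ℕ) : ℤ) * (b : ℤ) + (b : ℤ)) := by ring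
  have hlt : w i (j + 1) - w i j < (2 * ((B / b : ℕ) : ℤ) + 1 + 1) * (b : ℤ) := by rw [hring]; linarith
  have := Int.ediv_lt_of_lt_mul hbpos (a := w i (j + 1) - w i j) (b := 2 * ((B / b : ℕ) : ℤ) + 1 + 1) (by linarith)
  unfold pieceCount
  omega

/-- **… hence at most `(2(B∕b)+1)⁴` fine cells meet the coarse centre cell.** -/
theorem card_fineCells_centre_le_gen : ((cellEdges w 0).image (frameCell (refineGen b w))).card ≤ (2 * (B / b) + 1) ^ 4 := by
  refine (Finset.card_le_card (fineCells_centre_subset_gen hb hbB hw)).trans ?_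
  rw [Fintype.card_piFinset]
  have h : ∀ i : Fin 4, (Finset.Ico (0 : ℤ) (pieceCount b w i 0)).card ≤ 2 * (B / b) + 1 := fun i => by
    rw [Int.card_Ico, sub_zero]
    have := pieceCount_le hb hw i 0
    omega
  calc ∏ i : Fin 4, (Finset.Ico (0 : ℤ) (pieceCount b w i 0)).card ≤ ∏ _i : Fin 4, (2 * (B / b) + 1) :=
        Finset.prod_le_prod' fun i _ => h i
    _ = (2 * (B / b) + 1) ^ 4 := by rw [Finset.prod_const, Finset.card_univ, Fintype.card_fin]

omit hbB in
/-- `B∕b ≤ pieceCount` on a mesh-`B` frame (`gap ≥ B`). -/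
theorem div_le_pieceCount (i : Fin 4) (j : ℤ) : ((B / b : ℕ) : ℤ) ≤ pieceCount b w i j := by
  have hbpos : (0 : ℤ) < (b : ℤ) := by exact_mod_cast hb
  have hg := (hw i j).1
  have hB : ((B / b : ℕ) : ℤ) * (b : ℤ) ≤ (B : ℤ) := by exact_mod_cast Nat.div_mul_le_self B b
  exact Int.le_ediv_of_mul_le hbpos (by linarith)

/-- **Window geometry**: a fine cell within index distance `N ≤ 2(B∕b)` (per axis) of a fine cell of the coarse centre cell has coarse index in `[-2, 2]`. -/
theorem coarseIdx_mem_Icc_of_near {N : ℕ} (hN : N ≤ 2 * (B / b)) (i : Fin 4) {k y : ℤ} (hy0 : 0 ≤ y) (hy1 : y < pieceCount b w i 0)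
    (hk : |k - y| ≤ N) : -2 ≤ coarseIdx b w i k ∧ coarseIdx b w i k ≤ 2 := by
  have hc := cumPieces_step hb hbB hw i
  have hN' : (N : ℤ) ≤ 2 * ((B / b : ℕ) : ℤ) := by exact_mod_cast hN
  have hk' := abs_le.1 hk
  have hK1 := div_le_pieceCount hb hw i (-1)
  have hK2 := div_le_pieceCount hb hw i (-2)
  have hK3 := div_le_pieceCount hb hw i 1
  have hK4 := div_le_pieceCount hb hw i 2
  -- `cum (-2) = -(pc(-1) + pc(-2))`, `cum 3 = pc 0 + pc 1 + pc 2`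
  have hm1 : cumPieces b w i (-1) = -pieceCount b w i (-1) := by
    have := cumPieces_succ (b := b) (w := w) i (-1)
    rw [show (-1 : ℤ) + 1 = 0 by norm_num, cumPieces_zero] at this
    linarith
  have hm2 : cumPieces b w i (-2) = -pieceCount b w i (-1) - pieceCount b w i (-2) := by
    have := cumPieces_succ (b := b) (w := w) i (-2)
    rw [show (-2 : ℤ) + 1 = -1 by norm_num, hm1] at this
    linarith
  have hp1 : cumPieces b w i 1 = pieceCount b w i 0 := by
    have := cumPieces_succ (b := b) (w := w) i 0
    rw [zero_add, cumPieces_zero, zero_add] at this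
    exact this
  have hp2 : cumPieces b w i 2 = pieceCount b w i 0 + pieceCount b w i 1 := by
    have := cumPieces_succ (b := b) (w := w) i 1
    rw [show (1 : ℤ) + 1 = 2 by norm_num, hp1] at this
    exact this
  have hp3 : cumPieces b w i 3 = pieceCount b w i 0 + pieceCount b w i 1 + pieceCount b w i 2 := by
    have := cumPieces_succ (b := b) (w := w) i 2
    rw [show (2 : ℤ) + 1 = 3 by norm_num, hp2] at this
    exact this
  constructor
  · exact le_frameIdx_of_le hc (by rw [hm2]; linarith)
  · have := frameIdx_lt_of_lt hc (a := 3) (t := k) (by rw [hp3]; linarith)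
    unfold coarseIdx
    omega

end Cells

end Summit.QuantumFields.YangMills.Cruxes.IR.BlockedActivity

end
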